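/-
Copyright (c) 2026 the pub-hodgecm-mathlib formalisation cell (harness21).  Prover seat hodgecm-mathlib-K2Liu-p05 (g5), Track B «K2-LIT»,
#184♮ = hLiu418 = `stmt-HodgeConjecture-24832`; #42S payer road, organ S1 (local Siegel–Weil spanning), ROAD W file F4a, part 2 (the VALUE)
(LEAD F0P6-plan (g14) RULING «M-158a» (5); census K2Liu-p05 (g4) 2026-09-04T10:29:14Z, heads K2Liu-p05 (g5) 11:02Z on `K2/STATUS.md`).
-/
import Summits.HodgeConjecture.HodgeConjecture.Theorems.K2LiuLocalSWBigCellWords             -- part 1: the three operator words, `moverChange`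
import Literature.NumberTheory.GelbartRogawski1991.LocalDoubledWeylElementCayleyMover      -- ★ `exists_mover_conj_iotaD_weylDelta`
import HarnessLib

/-!
# Crux `HLiu418`, #42S organ S1, ROAD W, file F4a (part 2): THE BIG-CELL VALUE OF THE LOCAL SIEGEL–WEIL SECTION, UP TO ONE FREE SCALAR
# `F_Φ(w_Δ · n(t)) = γ · (𝓕 (m(B′) (n(c_t) (Γ Φ))))(0) = γ′ · ∫ ψ_v(−½⟨x, c_t x⟩) (Γ Φ)(x) dx`

Cell `hodgecm-mathlib`, crux item hLiu418 = `stmt-HodgeConjecture-24832`; squad K2 ∕ K2Liu; LEAD F0P6-plan (g14), organ lead K2Liu-p06 (g4);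
prover K2Liu-p05 (g5).  THEOREMS ONLY (no `def`, no instance, no notation, no named-fact hypothesis, no `sorry`); lane
`--supports stmt-HodgeConjecture-24832 --as helper`.

WHY.  ROAD W of organ S1 (`I_v(½, χ_v) = R₂(V⁺_v) + R₂(V⁻_v)`; census `K2/K2Liu-p06/g4/CENSUS-S1-LocalSWSpanning.K2Liu-p06-g4.md`, RULINGS «M-157t»,
«M-158a») reduces the spanning to ONE big-cell section with non-zero PROFILE `b ↦ F_Φ(w_Δ n(b))` (★ F2, ★ F3); this file computes that profile for the
local Siegel–Weil section ★ `swSectionLoc v s m₀ Φ h = (ω(m₀ · s h) Φ)(0)` (D-A v1) of the tree's doubled local Weil datum at GENERIC `(n, T₀, J^𝔻)`,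
UP TO ONE SCALAR free of `t` and `Φ` — all that (W2)∕(W3) consume (a non-zero profile sum is scale invariant).  SETTING and words: part 1
`K2LiuLocalSWBigCellWords` (binders of ★ `LocalDoubledSiegelUnipotentMover`; `D` a local splitting datum, OUTER implementer `m₀ ∈ S̃p_ψ(𝕎^𝔻_v)` over ANY
mover of `ℓ_Δ` onto `ℓ_Y` — e.g. the `(δ_v, deltaImpl v)` of record —, INNER Cayley-type mover-implementer `(E, Γ)` with `E ι(w_Δ) E⁻¹ = J_𝕋⁻¹ m(B′)`).

* **`exists_swSectionLoc_weylDelta_mul_nElem_eq`** — `∃ γ : ℂ, ∀ t ht Φ, swSectionLoc v D.localSplitting m₀ Φ (w_Δ * n(t)) = γ * (𝓕 (leviOpPi B′ (unipOpPi c_t (Γ Φ))))(0)`,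
  `c_t := cOfFix 𝕋 (E ι(n(t)) E⁻¹)`: `ω(s_D(w_Δ n(t))) = ω_D(w_Δ) ω_D(n(t))`, the unipotent and Weyl words of part 1 give
  `ω(m₀) (γ_w • Γ⁻¹ 𝓕 m(B′) n(c_t) Γ Φ)`, and `moverChange` turns `ev₀ ∘ ω(m₀) ∘ Γ⁻¹` into `κ · ev₀`.
* **`exists_swSectionLoc_weylDelta_mul_nElem_eq_integral`** — the INTEGRAL FORM `= γ′ * ∫ x, ψ_v(−(½ · x ⬝ᵥ (c_t x))) · (Γ Φ)(x) ∂μ^{⊗(n+n)}`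
  (the Fourier operator at `0` is the total integral; ★ `fourierOpPi_mul_leviOpPi` moves `B′` into the scalar).
* **`exists_swSectionLoc_weylDelta_mul_nElem_eq_integral_cm`** — the binder-free corollary for Kudla's CM datum ★ `localSplittingDatumCM` (split or not) and ANY
  `m₀` over a mover: `∃ E Γ γ′, …` (the Cayley mover of ★ `exists_mover_conj_iotaD_weylDelta`, `Γ := r(E)`, `hpar` by ★ part 1
  `parabolicAtUnipotents_localSplittingDatumCM`).
* the three statements again WITH `γ ≠ 0` ∕ `γ′ ≠ 0` (the organ lead's letter, DESIGN-W3-v2 §0 Q2): `exists_ne_zero_swSectionLoc_weylDelta_mul_nElem_eq`,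
  `…_integral`, `…_integral_cm` (★ part 1 `exists_swSectionLoc_ne_zero`: `Φ ↦ F_Φ(w_Δ · n(0))` is not identically zero).
NOT HERE (F4b): `tensorEmbLoc (w_Δ) = w_Δ′`, `tensorEmbLoc (n(b)) = n(b ⊗ 1)` (★∕📤 `K2LiuLocalSWTensorAdaptedBlocks.matA_tensorEmbLoc`) and the
instantiation at the S1 face's `(sLoc dV′, m₀ dV′)`; the `V′`-coordinate unwinding `⟨x, c_{b⊗1} x⟩ ↔ tr(b · G(x))` (★ `dotProduct_cOfFix_mover_conj`).
References: [Kudla1994] §3 Thm. 3.1; [Rangarao1993] §3.1 (3.9), Lemma 3.2 (3.8), Thm. 3.5; [MoeglinVignerasWaldspurger1987] Chap. 2 II.1 (A), II.6; [Weil1964] n° 13, n° 32;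
[HarrisKudlaSweet1996] §1 (1.15)–(1.16); [KudlaRallis1994] §1.  HONEST LABEL.  Count-neutral helper: `HC_CM` is proved only modulo the 7 printed citations
(2 remaining named inputs: hLiu418 = `stmt-HodgeConjecture-24832`, h413 = `stmt-HodgeConjecture-24833`) until rung 0 closes.
-/

set_option autoImplicit false
set_option linter.dupNamespace false -- the mandated namespace repeats `HodgeConjecture.HodgeConjecture`

noncomputable section

open scoped Matrix
open NumberField IsDedekindDomain MeasureTheory MeasureTheory.Measure Matrix
open Literature.RepresentationTheory.HeisenbergGroup Literature.RepresentationTheory.HeisenbergGroup.SymplecticMatrix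
open Literature.NumberTheory.Automorphic Literature.NumberTheory.Automorphic.UnitaryGroup Literature.NumberTheory.Weil1964
open Literature.NumberTheory.GaloisRepresentations Literature.NumberTheory.GaloisRepresentations.IsNonarchimedeanLocalField
open Literature.RepresentationTheory.HarrisKudlaSweet1996
open Literature.NumberTheory.GelbartRogawski1991.UnitaryDualPair
open Literature.NumberTheory.GelbartRogawski1991.UnitaryDualPair.LocalSplitting
open Summit.HodgeConjecture.HodgeConjecture.Cruxes.HLiu418.K2LiuLocalSWSectionDefs

open Summit.HodgeConjecture.HodgeConjecture.Cruxes.HLiu418.K2LiuLocalSWBigCellWords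

namespace Summit.HodgeConjecture.HodgeConjecture.Cruxes.HLiu418.K2LiuLocalSWBigCellFormula

section CM

variable (L : Type) [Field L] [NumberField L] [IsCMField L] (v : HeightOneSpectrum (𝓞 (maximalRealSubfield L)))
  [MeasurableSpace (v.adicCompletion (maximalRealSubfield L))] [BorelSpace (v.adicCompletion (maximalRealSubfield L))]
  (μ : Measure (v.adicCompletion (maximalRealSubfield L))) [μ.IsAddHaarMeasure]
  (n : ℕ) {T₀ : Matrix (Fin n) (Fin n) (maximalRealSubfield L)} (hT₀ : T₀.IsSymm) (hT₀d : IsUnit T₀.det)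
  {JD : Matrix (Fin (n + n)) (Fin (n + n)) L}
  (hJD : JD = (gramD (maximalRealSubfield L) n T₀).map (algebraMap (maximalRealSubfield L) L))
  (hTv : IsUnit (localGram (maximalRealSubfield L) (n + n) (gramD (maximalRealSubfield L) n T₀) v).det)

section Datum

variable {hTd' : IsUnit (gramD (maximalRealSubfield L) n T₀).det}
  {ℓ : Submodule (v.adicCompletion (maximalRealSubfield L))
    ((Fin (n + n) → v.adicCompletion (maximalRealSubfield L)) × (Fin (n + n) → v.adicCompletion (maximalRealSubfield L)))}
  {hℓ : LinearMap.BilinForm.orthogonal (alt (polar (localPairing (maximalRealSubfield L) (n + n) (gramD (maximalRealSubfield L) n T₀) v))) ℓ = ℓ}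
  (D : LocalSplittingDatum (maximalRealSubfield L) L (IsCMField.complexConj L) (n + n) (complexConj_imagUnit L) (imagUnit_ne_zero L)
    (imagUnit_mul_self L) (gramD (maximalRealSubfield L) n T₀) (gramD_isSymm (maximalRealSubfield L) n hT₀) hTd' hJD v μ ℓ hℓ)
  (E' : LocalSp (maximalRealSubfield L) (n + n) (gramD (maximalRealSubfield L) n T₀) v)
  (hE' : (deltaLagrangian (maximalRealSubfield L) v n).map (toLin (maximalRealSubfield L) v E') = lagrangianY (maximalRealSubfield L) (n + n) v)
  (Γ : SchwartzBruhat (Fin (n + n) → v.adicCompletion (maximalRealSubfield L)) ≃ₗ[ℂ]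
    SchwartzBruhat (Fin (n + n) → v.adicCompletion (maximalRealSubfield L)))
  (hΓ : Implements (localSchrodinger (maximalRealSubfield L) (n + n) (gramD (maximalRealSubfield L) n T₀) v) (ofSymplectic _ E') Γ)

/-! ## The big-cell value of the local Siegel–Weil section -/

variable (m₀ : LocalMp (maximalRealSubfield L) (n + n) (gramD (maximalRealSubfield L) n T₀) v)
  (hm₀ : (deltaLagrangian (maximalRealSubfield L) v n).map (toLin (maximalRealSubfield L) v (MpPsi.proj _ m₀)) =
    lagrangianY (maximalRealSubfield L) (n + n) v)

include hT₀d hE' hΓ hm₀ in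
set_option maxHeartbeats 4000000 in -- the metaplectic pair carrier `MpPsi (localSchrodinger …)` unfolds slowly (as ★ D-A `swSectionLoc_mul_right`, ★ #7b)
/-- **THE BIG-CELL VALUE OF THE LOCAL SIEGEL–WEIL SECTION, UP TO ONE FREE SCALAR.**  For a local splitting datum `D` (parabolic normalisation at the
unipotents through `Γ` by value, `hpar`), an OUTER implementer `m₀ ∈ S̃p_ψ(𝕎^𝔻_v)` whose projection is ANY mover of `ℓ_Δ` onto `ℓ_Y` (`hm₀`; e.g. the
`(δ_v, deltaImpl v)` of record) and an INNER Cayley-type mover-implementer `(E, Γ)` with `E ι(w_Δ) E⁻¹ = J_𝕋⁻¹ m(B′)`: there is ONE `γ ∈ ℂ` with, for every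
skew `t` and every `Φ`, `F_Φ(w_Δ · n(t)) = swSectionLoc v s_D m₀ Φ (w_Δ n(t)) = γ · (𝓕 (leviOpPi B′ (unipOpPi c_t (Γ Φ))))(0)`.  Proof:
`ω(s_D(w_Δ n(t))) = ω_D(w_Δ) ω_D(n(t))`, the unipotent and Weyl words of part 1 give `ω(m₀) (γ_w • Γ⁻¹ 𝓕 m(B′) n(c_t) Γ Φ)`, and ★ `moverChange`
turns `ev₀ ∘ ω(m₀) ∘ Γ⁻¹` into `κ · ev₀`.
[cite: Kudla1994, §3 Thm. 3.1] [cite: Rangarao1993, Lemma 3.2 (3.8)–(3.9), Thm. 3.5] [cite: MoeglinVignerasWaldspurger1987, Chap. 2 II.1 (A), II.6]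
[cite: KudlaRallis1994, §1] -/
theorem exists_swSectionLoc_weylDelta_mul_nElem_eq
    (hpar : ∀ (t : Matrix (Fin n) (Fin n) (LocalRing L v))
      (ht : (t.map (conjLocal L (IsCMField.complexConj L) v))ᵀ * gramS (maximalRealSubfield L) L v n T₀ +
        gramS (maximalRealSubfield L) L v n T₀ * t = 0)
      (Φ : SchwartzBruhat (Fin (n + n) → v.adicCompletion (maximalRealSubfield L))),
      ((Γ (D.localOmega (nElem (maximalRealSubfield L) L (IsCMField.complexConj L) v n hJD t ht) (Γ.symm Φ)) :
          SchwartzBruhat (Fin (n + n) → v.adicCompletion (maximalRealSubfield L))) :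
            (Fin (n + n) → v.adicCompletion (maximalRealSubfield L)) → ℂ) 0 =
        ((Φ : SchwartzBruhat (Fin (n + n) → v.adicCompletion (maximalRealSubfield L))) :
          (Fin (n + n) → v.adicCompletion (maximalRealSubfield L)) → ℂ) 0)
    (B' : GL (Fin (n + n)) (v.adicCompletion (maximalRealSubfield L)))
    (hW : E' * iotaD (maximalRealSubfield L) L (IsCMField.complexConj L) (complexConj_imagUnit L) (imagUnit_ne_zero L)
        (imagUnit_mul_self L) v n hT₀ hJD (weylDelta (maximalRealSubfield L) L (IsCMField.complexConj L) v n hJD) * E'⁻¹ =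
      (transportSp (localGram (maximalRealSubfield L) (n + n) (gramD (maximalRealSubfield L) n T₀) v) hTv (SymplecticGroup.symJ _ _))⁻¹ *
        transportSp (localGram (maximalRealSubfield L) (n + n) (gramD (maximalRealSubfield L) n T₀) v) hTv (levi B'))
    {m : ℤ} (hm : (adeleAddCharAt (maximalRealSubfield L) v).HasConductorExp m) :
    ∃ γ : ℂ, ∀ (t : Matrix (Fin n) (Fin n) (LocalRing L v))
      (ht : (t.map (conjLocal L (IsCMField.complexConj L) v))ᵀ * gramS (maximalRealSubfield L) L v n T₀ +
        gramS (maximalRealSubfield L) L v n T₀ * t = 0)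
      (Φ : SchwartzBruhat (Fin (n + n) → v.adicCompletion (maximalRealSubfield L))),
      swSectionLoc L v D.localSplitting m₀ Φ
          (weylDelta (maximalRealSubfield L) L (IsCMField.complexConj L) v n hJD *
            nElem (maximalRealSubfield L) L (IsCMField.complexConj L) v n hJD t ht) =
        γ * ((fourierOpPi μ (isContinuousNontrivial_adeleAddCharAt (maximalRealSubfield L) v) hm
          (leviOpPi (glEquiv B')
            (unipOpPi (isLocallyConstant_of_isContinuousNontrivial (isContinuousNontrivial_adeleAddCharAt (maximalRealSubfield L) v))
              (Matrix.mulVecLin (cOfFix (localGram (maximalRealSubfield L) (n + n) (gramD (maximalRealSubfield L) n T₀) v)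
                (E' * iotaD (maximalRealSubfield L) L (IsCMField.complexConj L) (complexConj_imagUnit L) (imagUnit_ne_zero L)
                  (imagUnit_mul_self L) v n hT₀ hJD (nElem (maximalRealSubfield L) L (IsCMField.complexConj L) v n hJD t ht) * E'⁻¹)))
              (Γ Φ))) : SchwartzBruhat (Fin (n + n) → v.adicCompletion (maximalRealSubfield L))) :
            (Fin (n + n) → v.adicCompletion (maximalRealSubfield L)) → ℂ) 0 := by
  obtain ⟨κ, hκ⟩ := exists_apply_zero_moverChange_eq_mul (maximalRealSubfield L) v (n + n) (gramD (maximalRealSubfield L) n T₀) hTv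
    (deltaLagrangian (maximalRealSubfield L) v n) E' (MpPsi.proj _ m₀) hE' hm₀ Γ (MpPsi.toOp _ m₀) hΓ (MpPsi.toRep_implements _ m₀)
  obtain ⟨γw, hγw⟩ := exists_localOmega_weylDelta_apply_eq_smul L v μ n hT₀ hJD hTv D E' Γ hΓ B' hW hm
  refine ⟨κ * (γw : ℂ), fun t ht Φ => ?_⟩
  -- (1) `ω(m₀ · s(w n)) Φ = ω(m₀) (ω(s w) (ω(s n) Φ))`
  have h1 := rep_mul_splitting_mul_apply D.localSplitting
    (MpPsi.toRep (localSchrodinger (maximalRealSubfield L) (n + n) (gramD (maximalRealSubfield L) n T₀) v)) m₀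
    (weylDelta (maximalRealSubfield L) L (IsCMField.complexConj L) v n hJD)
    (nElem (maximalRealSubfield L) L (IsCMField.complexConj L) v n hJD t ht) Φ
  -- (2) the unipotent word `ω(s n) Φ = Γ⁻¹ (unipOpPi c_t (Γ Φ))` (part 1 §2)
  have h2 : MpPsi.toRep (localSchrodinger (maximalRealSubfield L) (n + n) (gramD (maximalRealSubfield L) n T₀) v)
        (D.localSplitting (nElem (maximalRealSubfield L) L (IsCMField.complexConj L) v n hJD t ht)) Φ =
      Γ.symm (unipOpPi (isLocallyConstant_of_isContinuousNontrivial (isContinuousNontrivial_adeleAddCharAt (maximalRealSubfield L) v))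
        (Matrix.mulVecLin (cOfFix (localGram (maximalRealSubfield L) (n + n) (gramD (maximalRealSubfield L) n T₀) v)
          (E' * iotaD (maximalRealSubfield L) L (IsCMField.complexConj L) (complexConj_imagUnit L) (imagUnit_ne_zero L)
            (imagUnit_mul_self L) v n hT₀ hJD (nElem (maximalRealSubfield L) L (IsCMField.complexConj L) v n hJD t ht) * E'⁻¹)))
        (Γ Φ)) := by
    rw [LinearEquiv.eq_symm_apply]
    exact implementer_localOmega_nElem_apply L v μ n hT₀ hT₀d hJD D E' hE' Γ hΓ t ht (hpar t ht) Φ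
  -- (3) the Weyl word `ω(s w) Ψ = γ_w • Γ⁻¹ (𝓕 (m(B′) (Γ Ψ)))` (part 1 §3)
  have h3 : ∀ Ψ : SchwartzBruhat (Fin (n + n) → v.adicCompletion (maximalRealSubfield L)),
      MpPsi.toRep (localSchrodinger (maximalRealSubfield L) (n + n) (gramD (maximalRealSubfield L) n T₀) v)
          (D.localSplitting (weylDelta (maximalRealSubfield L) L (IsCMField.complexConj L) v n hJD)) Ψ =
        (γw : ℂ) • Γ.symm (fourierOpPi μ (isContinuousNontrivial_adeleAddCharAt (maximalRealSubfield L) v) hm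
          (leviOpPi (glEquiv B') (Γ Ψ))) :=
    fun Ψ => hγw Ψ
  -- (4) `ev₀ ∘ ω(m₀) ∘ Γ⁻¹ = κ · ev₀` (part 1 §1)
  have h4 : ∀ Ψ : SchwartzBruhat (Fin (n + n) → v.adicCompletion (maximalRealSubfield L)),
      ((MpPsi.toRep (localSchrodinger (maximalRealSubfield L) (n + n) (gramD (maximalRealSubfield L) n T₀) v) m₀ (Γ.symm Ψ) :
          SchwartzBruhat (Fin (n + n) → v.adicCompletion (maximalRealSubfield L))) :
            (Fin (n + n) → v.adicCompletion (maximalRealSubfield L)) → ℂ) 0 =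
        κ * ((Ψ : SchwartzBruhat (Fin (n + n) → v.adicCompletion (maximalRealSubfield L))) :
          (Fin (n + n) → v.adicCompletion (maximalRealSubfield L)) → ℂ) 0 :=
    fun Ψ => hκ Ψ
  unfold swSectionLoc
  rw [h1, h2, h3, LinearEquiv.apply_symm_apply, LinearMap.map_smul, Submodule.coe_smul, Pi.smul_apply, smul_eq_mul, h4]
  ring

include hT₀d hE' hΓ hm₀ in
set_option maxHeartbeats 4000000 in -- the metaplectic pair carrier `MpPsi (localSchrodinger …)` unfolds slowly (as ★ D-A `swSectionLoc_mul_right`, ★ #7b)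
/-- **THE BIG-CELL VALUE, INTEGRAL FORM**: with the same data, ONE `γ′ ∈ ℂ` with, for every skew `t` and every `Φ`,
`F_Φ(w_Δ · n(t)) = γ′ · ∫ x, ψ_v(−(½ · x ⬝ᵥ (c_t x))) · (Γ Φ)(x) dμ^{⊗(n+n)}(x)` — the Fourier operator at `0` is the total integral
(`ψ_v(x ⬝ᵥ 0) = 1`), and `𝓕 ∘ leviOpPi B′ = leviOpPi (B′)^{−ᵀ} ∘ 𝓕` (★ `fourierOpPi_mul_leviOpPi`) moves `B′` into the scalar `|det B′|^{1/2}`.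
[cite: Rangarao1993, §3.1 (3.9), Lemma 3.2 (3.8), p. 351, Thm. 3.5] [cite: Weil1964, n° 13 (16), (29), p. 160] [cite: Kudla1994, §3 Thm. 3.1]
[cite: KudlaRallis1994, §1] -/
theorem exists_swSectionLoc_weylDelta_mul_nElem_eq_integral
    (hpar : ∀ (t : Matrix (Fin n) (Fin n) (LocalRing L v))
      (ht : (t.map (conjLocal L (IsCMField.complexConj L) v))ᵀ * gramS (maximalRealSubfield L) L v n T₀ +
        gramS (maximalRealSubfield L) L v n T₀ * t = 0)
      (Φ : SchwartzBruhat (Fin (n + n) → v.adicCompletion (maximalRealSubfield L))),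
      ((Γ (D.localOmega (nElem (maximalRealSubfield L) L (IsCMField.complexConj L) v n hJD t ht) (Γ.symm Φ)) :
          SchwartzBruhat (Fin (n + n) → v.adicCompletion (maximalRealSubfield L))) :
            (Fin (n + n) → v.adicCompletion (maximalRealSubfield L)) → ℂ) 0 =
        ((Φ : SchwartzBruhat (Fin (n + n) → v.adicCompletion (maximalRealSubfield L))) :
          (Fin (n + n) → v.adicCompletion (maximalRealSubfield L)) → ℂ) 0)
    (B' : GL (Fin (n + n)) (v.adicCompletion (maximalRealSubfield L)))
    (hW : E' * iotaD (maximalRealSubfield L) L (IsCMField.complexConj L) (complexConj_imagUnit L) (imagUnit_ne_zero L)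
        (imagUnit_mul_self L) v n hT₀ hJD (weylDelta (maximalRealSubfield L) L (IsCMField.complexConj L) v n hJD) * E'⁻¹ =
      (transportSp (localGram (maximalRealSubfield L) (n + n) (gramD (maximalRealSubfield L) n T₀) v) hTv (SymplecticGroup.symJ _ _))⁻¹ *
        transportSp (localGram (maximalRealSubfield L) (n + n) (gramD (maximalRealSubfield L) n T₀) v) hTv (levi B'))
    {m : ℤ} (hm : (adeleAddCharAt (maximalRealSubfield L) v).HasConductorExp m) :
    ∃ γ' : ℂ, ∀ (t : Matrix (Fin n) (Fin n) (LocalRing L v))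
      (ht : (t.map (conjLocal L (IsCMField.complexConj L) v))ᵀ * gramS (maximalRealSubfield L) L v n T₀ +
        gramS (maximalRealSubfield L) L v n T₀ * t = 0)
      (Φ : SchwartzBruhat (Fin (n + n) → v.adicCompletion (maximalRealSubfield L))),
      swSectionLoc L v D.localSplitting m₀ Φ
          (weylDelta (maximalRealSubfield L) L (IsCMField.complexConj L) v n hJD *
            nElem (maximalRealSubfield L) L (IsCMField.complexConj L) v n hJD t ht) =
        γ' * ∫ x : Fin (n + n) → v.adicCompletion (maximalRealSubfield L),
          ((adeleAddCharAt (maximalRealSubfield L) v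
              (-(⅟(2 : v.adicCompletion (maximalRealSubfield L)) *
                (x ⬝ᵥ (cOfFix (localGram (maximalRealSubfield L) (n + n) (gramD (maximalRealSubfield L) n T₀) v)
                  (E' * iotaD (maximalRealSubfield L) L (IsCMField.complexConj L) (complexConj_imagUnit L) (imagUnit_ne_zero L)
                    (imagUnit_mul_self L) v n hT₀ hJD (nElem (maximalRealSubfield L) L (IsCMField.complexConj L) v n hJD t ht) * E'⁻¹) *ᵥ x)))) : ℂ) *
            ((Γ Φ : SchwartzBruhat (Fin (n + n) → v.adicCompletion (maximalRealSubfield L))) :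
              (Fin (n + n) → v.adicCompletion (maximalRealSubfield L)) → ℂ) x) ∂(Measure.pi fun _ => μ) := by
  obtain ⟨γ, hγ⟩ := exists_swSectionLoc_weylDelta_mul_nElem_eq L v μ n hT₀ hT₀d hJD hTv D E' hE' Γ hΓ m₀ hm₀ hpar B' hW hm
  refine ⟨γ * ((modSqrt (dualLeviPi (glEquiv B')) : ℂ))⁻¹, fun t ht Φ => ?_⟩
  rw [hγ t ht Φ, mul_assoc γ]
  congr 1
  -- move the Levi operator across the Fourier operator and evaluate at `0`
  have hFL := congrArg (fun T : SchwartzBruhat (Fin (n + n) → v.adicCompletion (maximalRealSubfield L)) ≃ₗ[ℂ]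
      SchwartzBruhat (Fin (n + n) → v.adicCompletion (maximalRealSubfield L)) =>
        T (unipOpPi (isLocallyConstant_of_isContinuousNontrivial (isContinuousNontrivial_adeleAddCharAt (maximalRealSubfield L) v))
          (Matrix.mulVecLin (cOfFix (localGram (maximalRealSubfield L) (n + n) (gramD (maximalRealSubfield L) n T₀) v)
            (E' * iotaD (maximalRealSubfield L) L (IsCMField.complexConj L) (complexConj_imagUnit L) (imagUnit_ne_zero L)
              (imagUnit_mul_self L) v n hT₀ hJD (nElem (maximalRealSubfield L) L (IsCMField.complexConj L) v n hJD t ht) * E'⁻¹))) (Γ Φ)))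
    (fourierOpPi_mul_leviOpPi μ (isContinuousNontrivial_adeleAddCharAt (maximalRealSubfield L) v) hm (glEquiv B'))
  simp only [LinearEquiv.mul_apply] at hFL
  rw [hFL, coe_leviOpPi_apply, LinearEquiv.map_zero, coe_fourierOpPi, piFourierSB_apply]
  congr 1
  refine integral_congr_ae (Filter.Eventually.of_forall fun x => ?_)
  simp only [dotProduct_zero, AddChar.map_zero_eq_one, Circle.coe_one, one_mul, coe_unipOpPi_apply, halfForm_apply,
    Matrix.mulVecLin_apply]

omit [MeasurableSpace (v.adicCompletion (maximalRealSubfield L))] [BorelSpace (v.adicCompletion (maximalRealSubfield L))] in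
/-- `t = 0` is skew: `n(0) = 1` is a Siegel unipotent. [cite: Kudla1994, §3] -/
theorem zero_skew : ((0 : Matrix (Fin n) (Fin n) (LocalRing L v)).map (conjLocal L (IsCMField.complexConj L) v))ᵀ *
      gramS (maximalRealSubfield L) L v n T₀ + gramS (maximalRealSubfield L) L v n T₀ * 0 = 0 := by
  rw [Matrix.map_zero _ (map_zero _), Matrix.transpose_zero, zero_mul, mul_zero, add_zero]

include hT₀d hE' hΓ hm₀ in
/-- **THE BIG-CELL VALUE with `γ ≠ 0`** (`exists_swSectionLoc_weylDelta_mul_nElem_eq` + ★ `exists_swSectionLoc_ne_zero`: `Φ ↦ F_Φ(w_Δ · n(0))` is not identically zero).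
[cite: Kudla1994, §3 Thm. 3.1] [cite: MoeglinVignerasWaldspurger1987, Chap. 2 II.1 (A)–(B), II.6] [cite: KudlaRallis1994, §1] -/
theorem exists_ne_zero_swSectionLoc_weylDelta_mul_nElem_eq
    (hpar : ∀ (t : Matrix (Fin n) (Fin n) (LocalRing L v))
      (ht : (t.map (conjLocal L (IsCMField.complexConj L) v))ᵀ * gramS (maximalRealSubfield L) L v n T₀ +
        gramS (maximalRealSubfield L) L v n T₀ * t = 0)
      (Φ : SchwartzBruhat (Fin (n + n) → v.adicCompletion (maximalRealSubfield L))),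
      ((Γ (D.localOmega (nElem (maximalRealSubfield L) L (IsCMField.complexConj L) v n hJD t ht) (Γ.symm Φ)) :
          SchwartzBruhat (Fin (n + n) → v.adicCompletion (maximalRealSubfield L))) :
            (Fin (n + n) → v.adicCompletion (maximalRealSubfield L)) → ℂ) 0 =
        ((Φ : SchwartzBruhat (Fin (n + n) → v.adicCompletion (maximalRealSubfield L))) :
          (Fin (n + n) → v.adicCompletion (maximalRealSubfield L)) → ℂ) 0)
    (B' : GL (Fin (n + n)) (v.adicCompletion (maximalRealSubfield L)))
    (hW : E' * iotaD (maximalRealSubfield L) L (IsCMField.complexConj L) (complexConj_imagUnit L) (imagUnit_ne_zero L)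
        (imagUnit_mul_self L) v n hT₀ hJD (weylDelta (maximalRealSubfield L) L (IsCMField.complexConj L) v n hJD) * E'⁻¹ =
      (transportSp (localGram (maximalRealSubfield L) (n + n) (gramD (maximalRealSubfield L) n T₀) v) hTv (SymplecticGroup.symJ _ _))⁻¹ *
        transportSp (localGram (maximalRealSubfield L) (n + n) (gramD (maximalRealSubfield L) n T₀) v) hTv (levi B'))
    {m : ℤ} (hm : (adeleAddCharAt (maximalRealSubfield L) v).HasConductorExp m) :
    ∃ γ : ℂ, γ ≠ 0 ∧ ∀ (t : Matrix (Fin n) (Fin n) (LocalRing L v))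
      (ht : (t.map (conjLocal L (IsCMField.complexConj L) v))ᵀ * gramS (maximalRealSubfield L) L v n T₀ +
        gramS (maximalRealSubfield L) L v n T₀ * t = 0)
      (Φ : SchwartzBruhat (Fin (n + n) → v.adicCompletion (maximalRealSubfield L))),
      swSectionLoc L v D.localSplitting m₀ Φ
          (weylDelta (maximalRealSubfield L) L (IsCMField.complexConj L) v n hJD *
            nElem (maximalRealSubfield L) L (IsCMField.complexConj L) v n hJD t ht) =
        γ * ((fourierOpPi μ (isContinuousNontrivial_adeleAddCharAt (maximalRealSubfield L) v) hm
          (leviOpPi (glEquiv B')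
            (unipOpPi (isLocallyConstant_of_isContinuousNontrivial (isContinuousNontrivial_adeleAddCharAt (maximalRealSubfield L) v))
              (Matrix.mulVecLin (cOfFix (localGram (maximalRealSubfield L) (n + n) (gramD (maximalRealSubfield L) n T₀) v)
                (E' * iotaD (maximalRealSubfield L) L (IsCMField.complexConj L) (complexConj_imagUnit L) (imagUnit_ne_zero L)
                  (imagUnit_mul_self L) v n hT₀ hJD (nElem (maximalRealSubfield L) L (IsCMField.complexConj L) v n hJD t ht) * E'⁻¹)))
              (Γ Φ))) : SchwartzBruhat (Fin (n + n) → v.adicCompletion (maximalRealSubfield L))) :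
            (Fin (n + n) → v.adicCompletion (maximalRealSubfield L)) → ℂ) 0 := by
  obtain ⟨γ, hγ⟩ := exists_swSectionLoc_weylDelta_mul_nElem_eq L v μ n hT₀ hT₀d hJD hTv D E' hE' Γ hΓ m₀ hm₀ hpar B' hW hm
  refine ⟨γ, fun h0 => ?_, hγ⟩
  have ht0 := zero_skew L v n (T₀ := T₀)
  obtain ⟨Φ, hΦ⟩ := exists_swSectionLoc_ne_zero L v n D.localSplitting m₀
    (weylDelta (maximalRealSubfield L) L (IsCMField.complexConj L) v n hJD * nElem (maximalRealSubfield L) L (IsCMField.complexConj L) v n hJD 0 ht0)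
  exact hΦ (by rw [hγ 0 ht0 Φ, h0, zero_mul])

include hT₀d hE' hΓ hm₀ in
/-- **THE INTEGRAL FORM with `γ′ ≠ 0`**. [cite: Rangarao1993, §3.1 (3.9), Lemma 3.2 (3.8), Thm. 3.5] [cite: Kudla1994, §3 Thm. 3.1] [cite: KudlaRallis1994, §1] -/
theorem exists_ne_zero_swSectionLoc_weylDelta_mul_nElem_eq_integral
    (hpar : ∀ (t : Matrix (Fin n) (Fin n) (LocalRing L v))
      (ht : (t.map (conjLocal L (IsCMField.complexConj L) v))ᵀ * gramS (maximalRealSubfield L) L v n T₀ +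
        gramS (maximalRealSubfield L) L v n T₀ * t = 0)
      (Φ : SchwartzBruhat (Fin (n + n) → v.adicCompletion (maximalRealSubfield L))),
      ((Γ (D.localOmega (nElem (maximalRealSubfield L) L (IsCMField.complexConj L) v n hJD t ht) (Γ.symm Φ)) :
          SchwartzBruhat (Fin (n + n) → v.adicCompletion (maximalRealSubfield L))) :
            (Fin (n + n) → v.adicCompletion (maximalRealSubfield L)) → ℂ) 0 =
        ((Φ : SchwartzBruhat (Fin (n + n) → v.adicCompletion (maximalRealSubfield L))) :
          (Fin (n + n) → v.adicCompletion (maximalRealSubfield L)) → ℂ) 0)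
    (B' : GL (Fin (n + n)) (v.adicCompletion (maximalRealSubfield L)))
    (hW : E' * iotaD (maximalRealSubfield L) L (IsCMField.complexConj L) (complexConj_imagUnit L) (imagUnit_ne_zero L)
        (imagUnit_mul_self L) v n hT₀ hJD (weylDelta (maximalRealSubfield L) L (IsCMField.complexConj L) v n hJD) * E'⁻¹ =
      (transportSp (localGram (maximalRealSubfield L) (n + n) (gramD (maximalRealSubfield L) n T₀) v) hTv (SymplecticGroup.symJ _ _))⁻¹ *
        transportSp (localGram (maximalRealSubfield L) (n + n) (gramD (maximalRealSubfield L) n T₀) v) hTv (levi B'))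
    {m : ℤ} (hm : (adeleAddCharAt (maximalRealSubfield L) v).HasConductorExp m) :
    ∃ γ' : ℂ, γ' ≠ 0 ∧ ∀ (t : Matrix (Fin n) (Fin n) (LocalRing L v))
      (ht : (t.map (conjLocal L (IsCMField.complexConj L) v))ᵀ * gramS (maximalRealSubfield L) L v n T₀ +
        gramS (maximalRealSubfield L) L v n T₀ * t = 0)
      (Φ : SchwartzBruhat (Fin (n + n) → v.adicCompletion (maximalRealSubfield L))),
      swSectionLoc L v D.localSplitting m₀ Φ
          (weylDelta (maximalRealSubfield L) L (IsCMField.complexConj L) v n hJD *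
            nElem (maximalRealSubfield L) L (IsCMField.complexConj L) v n hJD t ht) =
        γ' * ∫ x : Fin (n + n) → v.adicCompletion (maximalRealSubfield L),
          ((adeleAddCharAt (maximalRealSubfield L) v
              (-(⅟(2 : v.adicCompletion (maximalRealSubfield L)) *
                (x ⬝ᵥ (cOfFix (localGram (maximalRealSubfield L) (n + n) (gramD (maximalRealSubfield L) n T₀) v)
                  (E' * iotaD (maximalRealSubfield L) L (IsCMField.complexConj L) (complexConj_imagUnit L) (imagUnit_ne_zero L)
                    (imagUnit_mul_self L) v n hT₀ hJD (nElem (maximalRealSubfield L) L (IsCMField.complexConj L) v n hJD t ht) * E'⁻¹) *ᵥ x)))) : ℂ) *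
            ((Γ Φ : SchwartzBruhat (Fin (n + n) → v.adicCompletion (maximalRealSubfield L))) :
              (Fin (n + n) → v.adicCompletion (maximalRealSubfield L)) → ℂ) x) ∂(Measure.pi fun _ => μ) := by
  obtain ⟨γ', hγ'⟩ := exists_swSectionLoc_weylDelta_mul_nElem_eq_integral L v μ n hT₀ hT₀d hJD hTv D E' hE' Γ hΓ m₀ hm₀ hpar B' hW hm
  refine ⟨γ', fun h0 => ?_, hγ'⟩
  have ht0 := zero_skew L v n (T₀ := T₀)
  obtain ⟨Φ, hΦ⟩ := exists_swSectionLoc_ne_zero L v n D.localSplitting m₀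
    (weylDelta (maximalRealSubfield L) L (IsCMField.complexConj L) v n hJD * nElem (maximalRealSubfield L) L (IsCMField.complexConj L) v n hJD 0 ht0)
  exact hΦ (by rw [hγ' 0 ht0 Φ, h0, zero_mul])

end Datum

/-! ## The CM datum: the binder-free corollary -/

/-- **THE BIG-CELL VALUE FOR THE CM DATUM, BINDER-FREE**: for Kudla's splitting `D := localSplittingDatumCM` of the doubled unitary group at `v` and ANY
implementer `m₀` over a mover of `ℓ_Δ` onto `ℓ_Y` (e.g. the `(δ_v, deltaImpl v)` of record), there are a mover `E` (`E ℓ_Δ = ℓ_Y`), an implementer `Γ` of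
`E` and ONE `γ′ ∈ ℂ` with, for every skew `t` and every `Φ`,
`swSectionLoc v s_D m₀ Φ (w_Δ · n(t)) = γ′ · ∫ x, ψ_v(−(½ · x ⬝ᵥ (c_t x))) · (Γ Φ)(x) dμ^{⊗(n+n)}(x)`, `c_t = cOfFix 𝕋 (E ι(n(t)) E⁻¹)`
(witnesses: the Cayley mover of ★ `exists_mover_conj_iotaD_weylDelta`, `Γ := r(E)`, `hpar` by ★ part 1 `parabolicAtUnipotents_localSplittingDatumCM`).
[cite: Kudla1994, §3 Thm. 3.1] [cite: Rangarao1993, Lemma 3.2 (3.8)–(3.9), Thm. 3.5] [cite: Weil1964, n° 13 (16), (29), p. 160, n° 32]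
[cite: KudlaRallis1994, §1] [cite: HarrisKudlaSweet1996, §1 (1.15)–(1.16)] -/
theorem exists_swSectionLoc_weylDelta_mul_nElem_eq_integral_cm (χ : HeckeCharacter L) (hχ : IsSplittingChar L 1 χ)
    (m₀ : LocalMp (maximalRealSubfield L) (n + n) (gramD (maximalRealSubfield L) n T₀) v)
    (hm₀ : (deltaLagrangian (maximalRealSubfield L) v n).map (toLin (maximalRealSubfield L) v (MpPsi.proj _ m₀)) =
      lagrangianY (maximalRealSubfield L) (n + n) v)
    {m : ℤ} (hm : (adeleAddCharAt (maximalRealSubfield L) v).HasConductorExp m) :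
    ∃ (E' : LocalSp (maximalRealSubfield L) (n + n) (gramD (maximalRealSubfield L) n T₀) v)
      (Γ : SchwartzBruhat (Fin (n + n) → v.adicCompletion (maximalRealSubfield L)) ≃ₗ[ℂ]
        SchwartzBruhat (Fin (n + n) → v.adicCompletion (maximalRealSubfield L))) (γ' : ℂ),
      (deltaLagrangian (maximalRealSubfield L) v n).map (toLin (maximalRealSubfield L) v E') = lagrangianY (maximalRealSubfield L) (n + n) v ∧
      Implements (localSchrodinger (maximalRealSubfield L) (n + n) (gramD (maximalRealSubfield L) n T₀) v) (ofSymplectic _ E') Γ ∧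
      ∀ (t : Matrix (Fin n) (Fin n) (LocalRing L v))
        (ht : (t.map (conjLocal L (IsCMField.complexConj L) v))ᵀ * gramS (maximalRealSubfield L) L v n T₀ +
          gramS (maximalRealSubfield L) L v n T₀ * t = 0)
        (Φ : SchwartzBruhat (Fin (n + n) → v.adicCompletion (maximalRealSubfield L))),
        swSectionLoc L v (localSplittingDatumCM L v μ n hT₀ hT₀d hJD χ hχ).localSplitting m₀ Φ
            (weylDelta (maximalRealSubfield L) L (IsCMField.complexConj L) v n hJD *
              nElem (maximalRealSubfield L) L (IsCMField.complexConj L) v n hJD t ht) =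
          γ' * ∫ x : Fin (n + n) → v.adicCompletion (maximalRealSubfield L),
            ((adeleAddCharAt (maximalRealSubfield L) v
                (-(⅟(2 : v.adicCompletion (maximalRealSubfield L)) *
                  (x ⬝ᵥ (cOfFix (localGram (maximalRealSubfield L) (n + n) (gramD (maximalRealSubfield L) n T₀) v)
                    (E' * iotaD (maximalRealSubfield L) L (IsCMField.complexConj L) (complexConj_imagUnit L) (imagUnit_ne_zero L)
                      (imagUnit_mul_self L) v n hT₀ hJD (nElem (maximalRealSubfield L) L (IsCMField.complexConj L) v n hJD t ht) * E'⁻¹) *ᵥ x)))) : ℂ) *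
              ((Γ Φ : SchwartzBruhat (Fin (n + n) → v.adicCompletion (maximalRealSubfield L))) :
                (Fin (n + n) → v.adicCompletion (maximalRealSubfield L)) → ℂ) x) ∂(Measure.pi fun _ => μ) := by
  have hTv' := isUnit_det_localGram_gramD (maximalRealSubfield L) v n hT₀d
  obtain ⟨E', B', hE', hW⟩ := exists_mover_conj_iotaD_weylDelta (maximalRealSubfield L) L (IsCMField.complexConj L) (complexConj_imagUnit L)
    (imagUnit_ne_zero L) (imagUnit_mul_self L) v n hT₀ hT₀d hJD hTv'
  obtain ⟨γ', hγ'⟩ := exists_swSectionLoc_weylDelta_mul_nElem_eq_integral L v μ n hT₀ hT₀d hJD hTv'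
    (localSplittingDatumCM L v μ n hT₀ hT₀d hJD χ hχ) E' hE' ((localSplittingDatumCM L v μ n hT₀ hT₀d hJD χ hχ).r E')
    ((localSplittingDatumCM L v μ n hT₀ hT₀d hJD χ hχ).r.implements E') m₀ hm₀
    (fun t ht Φ => parabolicAtUnipotents_localSplittingDatumCM L v μ n hT₀ hT₀d hJD χ hχ E' hE' _
      ((localSplittingDatumCM L v μ n hT₀ hT₀d hJD χ hχ).r.implements E') t ht Φ) B' hW hm
  exact ⟨E', (localSplittingDatumCM L v μ n hT₀ hT₀d hJD χ hχ).r E', γ', hE',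
    (localSplittingDatumCM L v μ n hT₀ hT₀d hJD χ hχ).r.implements E', hγ'⟩

/-- **THE CM COROLLARY with `γ′ ≠ 0`** (binder-free; Kudla's CM datum, ANY implementer `m₀` over a mover).
[cite: Kudla1994, §3 Thm. 3.1] [cite: Rangarao1993, Lemma 3.2 (3.8)–(3.9), Thm. 3.5] [cite: Weil1964, n° 13 (16), (29), p. 160, n° 32] [cite: KudlaRallis1994, §1] -/
theorem exists_ne_zero_swSectionLoc_weylDelta_mul_nElem_eq_integral_cm (χ : HeckeCharacter L) (hχ : IsSplittingChar L 1 χ)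
    (m₀ : LocalMp (maximalRealSubfield L) (n + n) (gramD (maximalRealSubfield L) n T₀) v)
    (hm₀ : (deltaLagrangian (maximalRealSubfield L) v n).map (toLin (maximalRealSubfield L) v (MpPsi.proj _ m₀)) =
      lagrangianY (maximalRealSubfield L) (n + n) v)
    {m : ℤ} (hm : (adeleAddCharAt (maximalRealSubfield L) v).HasConductorExp m) :
    ∃ (E' : LocalSp (maximalRealSubfield L) (n + n) (gramD (maximalRealSubfield L) n T₀) v)
      (Γ : SchwartzBruhat (Fin (n + n) → v.adicCompletion (maximalRealSubfield L)) ≃ₗ[ℂ]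
        SchwartzBruhat (Fin (n + n) → v.adicCompletion (maximalRealSubfield L))) (γ' : ℂ),
      (deltaLagrangian (maximalRealSubfield L) v n).map (toLin (maximalRealSubfield L) v E') = lagrangianY (maximalRealSubfield L) (n + n) v ∧
      Implements (localSchrodinger (maximalRealSubfield L) (n + n) (gramD (maximalRealSubfield L) n T₀) v) (ofSymplectic _ E') Γ ∧ γ' ≠ 0 ∧
      ∀ (t : Matrix (Fin n) (Fin n) (LocalRing L v))
        (ht : (t.map (conjLocal L (IsCMField.complexConj L) v))ᵀ * gramS (maximalRealSubfield L) L v n T₀ +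
          gramS (maximalRealSubfield L) L v n T₀ * t = 0)
        (Φ : SchwartzBruhat (Fin (n + n) → v.adicCompletion (maximalRealSubfield L))),
        swSectionLoc L v (localSplittingDatumCM L v μ n hT₀ hT₀d hJD χ hχ).localSplitting m₀ Φ
            (weylDelta (maximalRealSubfield L) L (IsCMField.complexConj L) v n hJD *
              nElem (maximalRealSubfield L) L (IsCMField.complexConj L) v n hJD t ht) =
          γ' * ∫ x : Fin (n + n) → v.adicCompletion (maximalRealSubfield L),
            ((adeleAddCharAt (maximalRealSubfield L) v
                (-(⅟(2 : v.adicCompletion (maximalRealSubfield L)) *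
                  (x ⬝ᵥ (cOfFix (localGram (maximalRealSubfield L) (n + n) (gramD (maximalRealSubfield L) n T₀) v)
                    (E' * iotaD (maximalRealSubfield L) L (IsCMField.complexConj L) (complexConj_imagUnit L) (imagUnit_ne_zero L)
                      (imagUnit_mul_self L) v n hT₀ hJD (nElem (maximalRealSubfield L) L (IsCMField.complexConj L) v n hJD t ht) * E'⁻¹) *ᵥ x)))) : ℂ) *
              ((Γ Φ : SchwartzBruhat (Fin (n + n) → v.adicCompletion (maximalRealSubfield L))) :
                (Fin (n + n) → v.adicCompletion (maximalRealSubfield L)) → ℂ) x) ∂(Measure.pi fun _ => μ) := by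
  obtain ⟨E', Γ, γ', hE', hΓ, hγ'⟩ := exists_swSectionLoc_weylDelta_mul_nElem_eq_integral_cm L v μ n hT₀ hT₀d hJD χ hχ m₀ hm₀ hm
  refine ⟨E', Γ, γ', hE', hΓ, fun h0 => ?_, hγ'⟩
  have ht0 := zero_skew L v n (T₀ := T₀)
  obtain ⟨Φ, hΦ⟩ := exists_swSectionLoc_ne_zero L v n (localSplittingDatumCM L v μ n hT₀ hT₀d hJD χ hχ).localSplitting m₀
    (weylDelta (maximalRealSubfield L) L (IsCMField.complexConj L) v n hJD * nElem (maximalRealSubfield L) L (IsCMField.complexConj L) v n hJD 0 ht0)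
  exact hΦ (by rw [hγ' 0 ht0 Φ, h0, zero_mul])

end CM

end Summit.HodgeConjecture.HodgeConjecture.Cruxes.HLiu418.K2LiuLocalSWBigCellFormula

end
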